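import Mathlib
import Summits.NavierStokesRegularity.NavierStokesRegularity.Theorems.L3TimeExponentPincerScaledEnergyModulation
import Literature.Analysis.FluidPDE.ClassicalSuitable
import Literature.Analysis.FluidPDE.NSSuitableESSProofs
import HarnessLib.Audit
import HarnessLib

/-!
# The scaled energy at one time controls the scaled dissipation and the cubic functional on the
# causal cylinder (route `L3TimeExponentPincer`, crux `L3CascadeJaw`, stmt-NavierStokesRegularity-19499)

Support file for the parent crux `L3CascadeJaw` (cell ns-regularity-ideate, seat nsreg-p4 gen 6), completing the
transport of the Lemarié-Rieusset / Jia–Šverák local-energy a priori estimate to the route's frame begun in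
`…Theorems.L3TimeExponentPincerScaledEnergyModulation` (there: the ENERGY clause — the worst-ball scaled energy
`Φ_r` cannot grow by more than an absolute factor within the causal window `ε₁ r² min(ν⁻¹, ν³/Φ_r²)`).  Here the
two other conclusions of Jia–Šverák 2014 Lemma 3.1 are transported to every scale `r` and interior time `t₀`:

* `exists_causalCylinder_bounds` — **absolute `ε₁ > 0`, `K_E, K_C ≥ 0` such that for every frame solution
  (`ν, T > 0`, classical on `[0,T)`, Leray–Hopf from a rapidly decaying datum), every `t₀ ∈ (0,T)`, `r > 0`,
  `A > 0` with `∫_{B(x,r)} |u(t₀)|² ≤ A r` for ALL centres `x`, on the CAUSAL CYLINDER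
  `Q = (t₀, t₀ + τ) × B(x, r)`, `τ = min(ε₁ r² min(ν⁻¹, ν³/A²), T - t₀)`, at every centre `x`:**
  **`∫∫_Q |∇u|² ≤ K_E · A r / ν`** (scaled dissipation `E(Q) = r⁻¹ ∫∫_Q |∇u|² ≤ K_E A/ν`) and
  **`∫∫_Q |u|³ ≤ K_C · A^{3/2} r² / ν`** (scaled cubic functional `C(Q) = r⁻² ∫∫_Q |u|³ ≤ K_C A^{3/2}/ν`).
  Together with the energy clause: the single-time worst-ball scaled energy `sup_x A_r(t₀)` controls the three
  velocity CKN quantities `A, E, C` on the causal cylinders of scale `r` — the "scaled-energy Type I ⇒ Type I in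
  `A, E, C`" half of Seregin's equivalence, at every scale, for the frame, with absolute constants.

Proof (tree theorems only): Seregin's rescaled restart at `(t₀, x)`, scale `r`, unit viscosity
(`IsLerayHopfOn.exists_isLocalEnergySolutionOn_rescaled_restart`), whose datum has unit-ball energies `≤ A/ν²`;
Jia–Šverák's unit-scale estimate (`JiaSverak2014.apriori_unit_scale_slab`) bounds unit-ball energies, unit-box
dissipations (of a weak gradient) and — via the interpolation lemma `JiaSverak2014.exists_lintegral_cube_window_le_slab`
— the unit-box cubic integral of the rescaled field; the weak gradient is identified with the rescaled classical
gradient (`hasWeakSpatialGradientOn_of_contDiffOn`, `HasWeakSpatialGradientOn.stRescale`, a.e. uniqueness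
`HasWeakSpatialGradientOn.ae_eq`), and the space–time change of variables
(`setLIntegral_frobeniusNormSq_stRescale`, `setLIntegral_enorm_pow_stRescale`, `stAffine_preimage_cylinder`)
carries both bounds back.
References: H. Jia, V. Šverák, Invent. Math. 196 (2014), Lemma 3.1; G. Seregin, *Lecture notes on regularity
theory for the Navier–Stokes equations* (2014), Ch. 6 (scaled energy quantities; `A` bounded ⇔ `A, C, E, D`
bounded for suitable weak solutions); G. Seregin, CMP 312 (2012) §2.
WHAT THIS IS NOT: not a claim about Navier–Stokes regularity or blow-up; an energy-class a priori estimate in the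
crux's exact frame, landed `--supports` as a helper; no item is closed.
-/

noncomputable section

namespace Summit.NavierStokesRegularity.NavierStokesRegularity.Theorems.L3TimeExponentPincerScaledEnergyCausalCylinder

open MeasureTheory Set Function Filter Metric Topology TopologicalSpace
open scoped ENNReal NNReal
open Literature.Analysis.FluidPDE
open Summit.NavierStokesRegularity.NavierStokesRegularity.Theorems.L3TimeExponentPincerStubParabolicConcentration
  (eLpNorm_top_Icc_lt_top_of_frame)
open Summit.NavierStokesRegularity.NavierStokesRegularity.Theorems.L3TimeExponentPincerScaledEnergyModulation
  (lintegral_unitBall_rescaled rescale_factor_mul)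

/-! ## §1  Arithmetic of the scale factors -/

/-- The dissipation scale factor: `(r/ν · r)² · (β r³)⁻¹ = (ν r)⁻¹` with `β = r²/ν` (in `ℝ≥0∞`). -/
theorem dissip_factor_eq {ν r : ℝ} (hν : 0 < ν) (hr : 0 < r) :
    ENNReal.ofReal ((r / ν * r) ^ 2) * ENNReal.ofReal (r ^ 2 / ν * r ^ 3)⁻¹ = ENNReal.ofReal ((ν * r)⁻¹) := by
  rw [← ENNReal.ofReal_mul (by positivity)]
  congr 1
  field_simp

/-- `‖r/ν‖ₑ³ · (β r³)⁻¹ = ofReal ((ν² r²)⁻¹)` with `β = r²/ν`. -/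
theorem cubic_factor_eq {ν r : ℝ} (hν : 0 < ν) (hr : 0 < r) :
    ‖r / ν‖ₑ ^ 3 * ENNReal.ofReal (r ^ 2 / ν * r ^ 3)⁻¹ = ENNReal.ofReal ((ν ^ 2 * r ^ 2)⁻¹) := by
  rw [Real.enorm_eq_ofReal (by positivity : (0:ℝ) ≤ r / ν), ← ENNReal.ofReal_pow (by positivity),
    ← ENNReal.ofReal_mul (by positivity)]
  congr 1
  field_simp

/-- From `ofReal c * X ≤ B` with `c > 0` to `X ≤ ofReal c⁻¹ * B`. -/
theorem le_inv_mul_of_ofReal_mul_le {c : ℝ} (hc : 0 < c) {X B : ℝ≥0∞} (h : ENNReal.ofReal c * X ≤ B) :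
    X ≤ ENNReal.ofReal c⁻¹ * B := by
  have hc0 : ENNReal.ofReal c ≠ 0 := (ENNReal.ofReal_pos.2 hc).ne'
  calc X = ENNReal.ofReal c⁻¹ * (ENNReal.ofReal c * X) := by
        rw [← mul_assoc, ENNReal.ofReal_inv_of_pos hc, ENNReal.inv_mul_cancel hc0 ENNReal.ofReal_ne_top, one_mul]
    _ ≤ ENNReal.ofReal c⁻¹ * B := mul_le_mul' le_rfl h

/-! ## §2  The causal-cylinder bounds -/

/-- **The scaled energy at one time controls `E` and `C` on the causal cylinder (Jia–Šverák 2014 Lemma 3.1,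
dissipation and cubic clauses, for the frame at every scale).**  There are absolute constants `ε₁ > 0` and
`K_E, K_C ≥ 0` such that: for every `ν, T > 0`, every classical solution `(u,p)` of the unforced system on
`ℝ³ × [0,T)` which is Leray–Hopf on `[0,T)` from its rapidly decaying datum, every `t₀ ∈ (0,T)`, `r > 0`, `A > 0`
with `∫_{B(x,r)} |u(t₀)|² ≤ A r` for all centres `x`, and every centre `x`, on the causal cylinder
`(t₀, t₀ + τ) × B(x,r)`, `τ = min(ε₁ r² min(ν⁻¹, ν³/A²), T - t₀)`:
`∫∫ |∇u|²_F ≤ K_E A r/ν` and `∫∫ |u|³ ≤ K_C A^{3/2} r²/ν`.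
[cite: JiaSverak2014, Lemma 3.1 (arXiv:1204.0529 p. 7)] [cite: Seregin2012CMP, §2 (2.3)–(2.4)] -/
theorem exists_causalCylinder_bounds :
    ∃ ε₁ : ℝ, 0 < ε₁ ∧ ∃ K_E : ℝ, 0 ≤ K_E ∧ ∃ K_C : ℝ, 0 ≤ K_C ∧
      ∀ (ν T : ℝ), 0 < ν → 0 < T →
      ∀ (u : ℝ → EuclideanSpace ℝ (Fin 3) → EuclideanSpace ℝ (Fin 3)) (p : ℝ → EuclideanSpace ℝ (Fin 3) → ℝ),
        IsClassicalNSSolutionOn (Ico 0 T) ν 0 u p → IsLerayHopfOn T ν 0 (u 0) u → HasRapidSpatialDecay (u 0) →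
        ∀ t₀ ∈ Ioo 0 T, ∀ r : ℝ, 0 < r → ∀ A : ℝ, 0 < A →
          (∀ x : EuclideanSpace ℝ (Fin 3), ∫⁻ y in ball x r, ‖u t₀ y‖ₑ ^ 2 ≤ ENNReal.ofReal (A * r)) →
          ∀ x : EuclideanSpace ℝ (Fin 3),
            (∫⁻ z in Ioo t₀ (t₀ + min (ε₁ * r ^ 2 * min ν⁻¹ (ν ^ 3 / A ^ 2)) (T - t₀)) ×ˢ ball x r,
                ENNReal.ofReal (frobeniusNormSq (fderiv ℝ (u z.1) z.2))) ≤ ENNReal.ofReal (K_E * A * r / ν) ∧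
            (∫⁻ z in Ioo t₀ (t₀ + min (ε₁ * r ^ 2 * min ν⁻¹ (ν ^ 3 / A ^ 2)) (T - t₀)) ×ˢ ball x r,
                ‖u z.1 z.2‖ₑ ^ (3 : ℕ)) ≤ ENNReal.ofReal (K_C * A ^ (3 / 2 : ℝ) * r ^ 2 / ν) := by
  obtain ⟨ε₀, hε₀, hε₀1, C, hAP⟩ := JiaSverak2014.apriori_unit_scale_slab
  obtain ⟨Kc, hKc⟩ := JiaSverak2014.exists_lintegral_cube_window_le_slab (1 : ℝ)
  have hε₀' : (0 : ℝ) < ε₀ := by exact_mod_cast hε₀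
  have hε₀1' : (ε₀ : ℝ) ≤ 1 := by exact_mod_cast hε₀1
  refine ⟨ε₀, hε₀', C, C.coe_nonneg, 2 * Kc * (C : ℝ) ^ (3 / 2 : ℝ), by positivity, ?_⟩
  intro ν T hν hT u p hcl hLH hdec t₀ ht₀ r hr A hA hdat x
  -- ### Seregin's rescaled restart at `(t₀, x)`, scale `r`, unit viscosity
  have hreg : ∀ s ∈ Ioo 0 T, ∀ y : EuclideanSpace ℝ (Fin 3), IsRegularPoint u (s, y) := fun s hs y =>
    isRegularPoint_of_eLpNorm_Icc_lt_top (eLpNorm_top_Icc_lt_top_of_frame hν hcl hLH hdec) hs y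
  obtain ⟨π, hU⟩ := hLH.exists_isLocalEnergySolutionOn_rescaled_restart hν hT hreg ht₀ hr x
  set β : ℝ := r ^ 2 / ν with hβ
  have hβpos : 0 < β := by rw [hβ]; positivity
  set Tsl : ℝ := ν * (T - t₀) / r ^ 2 with hTsl
  have hTt₀ : 0 < T - t₀ := sub_pos.2 ht₀.2
  have hTsl_pos : 0 < Tsl := by rw [hTsl]; positivity
  have hβTsl : β * Tsl = T - t₀ := by rw [hβ, hTsl]; field_simp
  -- the rescaled field as a pull-back
  have hUeq : (fun s y => (r / ν) • u (t₀ + r ^ 2 / ν * s) (x + r • y)) = (r / ν) • stPull β r t₀ x u := by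
    funext s y
    rw [smul_stPull_apply]
  -- the datum: measurable with unit-ball energies `≤ A/ν² = 2α`
  have hcont_t₀ : Continuous (u t₀) := (hcl.contDiff_velocity ⟨ht₀.1.le, ht₀.2⟩).continuous
  have hU₀m : AEStronglyMeasurable (fun y => (r / ν) • u t₀ (x + r • y)) volume := by
    have h1 : Continuous fun y : EuclideanSpace ℝ (Fin 3) => x + r • y := by fun_prop
    exact ((hcont_t₀.comp h1).const_smul (r / ν)).aestronglyMeasurable
  set α : ℝ≥0 := (A / (2 * ν ^ 2)).toNNReal with hα
  have hα_coe : (α : ℝ) = A / (2 * ν ^ 2) := Real.coe_toNNReal _ (by positivity)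
  have h2α : 2 * (α : ℝ≥0∞) = ENNReal.ofReal (A / ν ^ 2) := by
    rw [← ENNReal.ofReal_coe_nnreal, hα_coe, ← ENNReal.ofReal_ofNat 2, ← ENNReal.ofReal_mul (by norm_num)]
    congr 1
    field_simp
  have hCα : ((C * α : ℝ≥0) : ℝ≥0∞) = ENNReal.ofReal (C * A / (2 * ν ^ 2)) := by
    rw [← ENNReal.ofReal_coe_nnreal, NNReal.coe_mul, hα_coe]
    congr 1
    field_simp
  have hU₀small : ∀ y₀ : EuclideanSpace ℝ (Fin 3),
      ∫⁻ y in ball y₀ 1, ‖(r / ν) • u t₀ (x + r • y)‖ₑ ^ 2 ≤ 2 * (α : ℝ≥0∞) := by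
    intro y₀
    rw [lintegral_unitBall_rescaled (u t₀) hν hr x y₀, h2α, ← rescale_factor_mul A hν hr]
    gcongr
    exact hdat _
  -- a weak gradient of the restarted solution on its slab (JS's `G`)
  obtain ⟨G₁, hG₁, -, -⟩ := hU.suitable.localEnergy
  -- ### the JS window `S'` and the a priori estimate at unit scale
  set S' : ℝ := min ((ε₀ : ℝ) * min 1 (4 * ν ^ 4 / A ^ 2)) Tsl with hS'
  have hS'pos : 0 < S' := lt_min (by positivity) hTsl_pos
  have hS'Tsl : S' ≤ Tsl := min_le_right _ _
  have hS'ε : S' ≤ (ε₀ : ℝ) :=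
    (min_le_left _ _).trans (by nlinarith [min_le_left (1 : ℝ) (4 * ν ^ 4 / A ^ 2), hε₀'.le])
  have hS'1 : S' ≤ 1 := hS'ε.trans hε₀1'
  have hS'α : S' * (α : ℝ) ^ 2 ≤ (ε₀ : ℝ) := by
    have h1 : S' ≤ (ε₀ : ℝ) * (4 * ν ^ 4 / A ^ 2) :=
      (min_le_left _ _).trans (mul_le_mul_of_nonneg_left (min_le_right _ _) hε₀'.le)
    have h2 : (α : ℝ) ^ 2 = A ^ 2 / (4 * ν ^ 4) := by rw [hα_coe]; field_simp; ring
    rw [h2]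
    calc S' * (A ^ 2 / (4 * ν ^ 4)) ≤ (ε₀ : ℝ) * (4 * ν ^ 4 / A ^ 2) * (A ^ 2 / (4 * ν ^ 4)) :=
          mul_le_mul_of_nonneg_right h1 (by positivity)
      _ = ε₀ := by field_simp
  obtain ⟨hE, hD, -⟩ := hAP _ _ π G₁ α Tsl S' hU₀m hU.isLocalLeraySolutionOn hG₁ hU₀small hS'pos hS'Tsl hS'ε hS'α
  -- ### the causal cylinder is inside the JS window
  have hmin : (ε₀ : ℝ) * r ^ 2 * min ν⁻¹ (ν ^ 3 / A ^ 2) ≤ β * ((ε₀ : ℝ) * min 1 (4 * ν ^ 4 / A ^ 2)) := by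
    have h1 : min ν⁻¹ (ν ^ 3 / A ^ 2) ≤ ν⁻¹ * min 1 (4 * ν ^ 4 / A ^ 2) := by
      rw [mul_min_of_nonneg _ _ (inv_nonneg.2 hν.le), mul_one]
      refine le_min (min_le_left _ _) ((min_le_right _ _).trans ?_)
      rw [div_le_iff₀ (by positivity)]
      field_simp
      nlinarith [pow_pos hν 3]
    calc (ε₀ : ℝ) * r ^ 2 * min ν⁻¹ (ν ^ 3 / A ^ 2) ≤ (ε₀ : ℝ) * r ^ 2 * (ν⁻¹ * min 1 (4 * ν ^ 4 / A ^ 2)) :=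
          mul_le_mul_of_nonneg_left h1 (by positivity)
      _ = β * ((ε₀ : ℝ) * min 1 (4 * ν ^ 4 / A ^ 2)) := by rw [hβ]; ring
  have hβS' : β * S' = min (β * ((ε₀ : ℝ) * min 1 (4 * ν ^ 4 / A ^ 2))) (T - t₀) := by
    rw [hS', mul_min_of_nonneg _ _ hβpos.le, hβTsl]
  set τ : ℝ := min ((ε₀ : ℝ) * r ^ 2 * min ν⁻¹ (ν ^ 3 / A ^ 2)) (T - t₀) with hτ
  have hτle : τ ≤ β * S' := by
    rw [hβS', hτ]
    exact min_le_min hmin le_rfl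
  -- the original cylinder over the JS window and its rescaled preimage `(0,S') × B(0,1)`
  set Scyl : Set (ℝ × EuclideanSpace ℝ (Fin 3)) := Ioo t₀ (t₀ + β * S') ×ˢ ball x r with hScyl
  have hpre : stAffine β r t₀ x ⁻¹' Scyl = Ioo 0 S' ×ˢ ball (0 : EuclideanSpace ℝ (Fin 3)) 1 := by
    have e2 : (t₀ + β * S' - t₀) / β = S' := by field_simp; ring
    have e3 : r / r = 1 := div_self hr.ne'
    rw [hScyl, stAffine_preimage_cylinder hβpos hr, sub_self, sub_self, smul_zero, zero_div, e2, e3]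
  have hsubcyl : Ioo t₀ (t₀ + τ) ×ˢ ball x r ⊆ Scyl := prod_mono (Ioo_subset_Ioo_right (by linarith)) Subset.rfl
  -- the box `(0,S') × B(0,1)` lies in the slab of the restart
  have hbox_slab : Ioo 0 S' ×ˢ ball (0 : EuclideanSpace ℝ (Fin 3)) 1 ⊆
      ((slab (EuclideanSpace ℝ (Fin 3)) (Ioo 0 Tsl) isOpen_Ioo : Opens (ℝ × EuclideanSpace ℝ (Fin 3))) :
        Set (ℝ × EuclideanSpace ℝ (Fin 3))) := by
    rw [coe_slab]
    exact prod_mono (Ioo_subset_Ioo_right hS'Tsl) (subset_univ _)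
  -- ### (i) dissipation: identify JS's weak gradient with the rescaled classical gradient
  set G₀ : ℝ → EuclideanSpace ℝ (Fin 3) → EuclideanSpace ℝ (Fin 3) →L[ℝ] EuclideanSpace ℝ (Fin 3) :=
    fun t z => fderiv ℝ (u t) z with hG₀
  have hu1 : ContDiffOn ℝ 1 (uncurry u) (Ioo 0 T ×ˢ (univ : Set (EuclideanSpace ℝ (Fin 3)))) :=
    ContDiffOn.of_le (hcl.smooth_velocity.mono Ioo_subset_Ico_self) (by norm_cast)
  have hG₀w : HasWeakSpatialGradientOn (slab (EuclideanSpace ℝ (Fin 3)) (Ioo 0 T) isOpen_Ioo) u G₀ :=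
    hasWeakSpatialGradientOn_of_contDiffOn isOpen_Ioo (by rw [coe_slab]) hu1
  have hGpull₀ := hG₀w.stRescale (r / ν) hβpos hr t₀ x
  have hle_slab : (slab (EuclideanSpace ℝ (Fin 3)) (Ioo 0 Tsl) isOpen_Ioo : Opens (ℝ × EuclideanSpace ℝ (Fin 3))) ≤
      stPreimage β r t₀ x (slab (EuclideanSpace ℝ (Fin 3)) (Ioo 0 T) isOpen_Ioo) := by
    intro z hz
    rw [mem_stPreimage, mem_slab, stAffine_fst]
    have hz' : z.1 ∈ Ioo 0 Tsl := mem_slab.1 hz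
    constructor
    · have : 0 < β * z.1 := mul_pos hβpos hz'.1
      linarith [ht₀.1]
    · have : β * z.1 < β * Tsl := mul_lt_mul_of_pos_left hz'.2 hβpos
      linarith
  have hGpull : HasWeakSpatialGradientOn (slab (EuclideanSpace ℝ (Fin 3)) (Ioo 0 Tsl) isOpen_Ioo)
      (fun s y => (r / ν) • u (t₀ + r ^ 2 / ν * s) (x + r • y)) ((r / ν * r) • stPull β r t₀ x G₀) := by
    rw [hUeq]
    exact hGpull₀.mono hle_slab
  have hGae := hG₁.ae_eq hGpull
  have hGbox : ∀ᵐ z ∂(volume.restrict (Ioo 0 S' ×ˢ ball (0 : EuclideanSpace ℝ (Fin 3)) 1)),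
      uncurry G₁ z = uncurry ((r / ν * r) • stPull β r t₀ x G₀) z :=
    ae_restrict_of_ae_restrict_of_subset hbox_slab hGae
  have hD0 : ∫⁻ z in Ioo 0 S' ×ˢ ball (0 : EuclideanSpace ℝ (Fin 3)) 1,
      ENNReal.ofReal (frobeniusNormSq (G₁ z.1 z.2)) ≤ ((C * α : ℝ≥0) : ℝ≥0∞) := hD 0
  have hDpull : ∫⁻ z in Ioo 0 S' ×ˢ ball (0 : EuclideanSpace ℝ (Fin 3)) 1,
      ENNReal.ofReal (frobeniusNormSq (((r / ν * r) • stPull β r t₀ x G₀) z.1 z.2)) ≤ ((C * α : ℝ≥0) : ℝ≥0∞) := by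
    refine le_of_eq_of_le (lintegral_congr_ae (hGbox.mono fun z hz => ?_)) hD0
    change ENNReal.ofReal (frobeniusNormSq (uncurry ((r / ν * r) • stPull β r t₀ x G₀) z)) =
      ENNReal.ofReal (frobeniusNormSq (uncurry G₁ z))
    rw [hz]
  have hDorig : ENNReal.ofReal ((ν * r)⁻¹) *
      ∫⁻ z in Scyl, ENNReal.ofReal (frobeniusNormSq (G₀ z.1 z.2)) ≤ ENNReal.ofReal (C * A / (2 * ν ^ 2)) := by
    have h := setLIntegral_frobeniusNormSq_stRescale hβpos hr t₀ x (r / ν * r) G₀ Scyl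
    rw [hpre, finrank_euclideanSpace_fin, dissip_factor_eq hν hr] at h
    rw [← h, ← hCα]
    exact hDpull
  have hEfin : ∫⁻ z in Scyl, ENNReal.ofReal (frobeniusNormSq (G₀ z.1 z.2)) ≤ ENNReal.ofReal (C * A * r / ν) := by
    have h := le_inv_mul_of_ofReal_mul_le (by positivity) hDorig
    refine h.trans ?_
    rw [inv_inv, ← ENNReal.ofReal_mul (by positivity)]
    refine ENNReal.ofReal_le_ofReal ?_
    have e : ν * r * (C * A / (2 * ν ^ 2)) = C * A * r / ν / 2 := by field_simp
    rw [e]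
    exact half_le_self (by positivity)
  -- ### (ii) cubic: JS's interpolation on the unit box, then transport
  set Mb : ℝ≥0∞ := 2 * ((C * α : ℝ≥0) : ℝ≥0∞) with hMb
  have hMbtop : Mb ≠ ⊤ := ENNReal.mul_ne_top ENNReal.ofNat_ne_top ENNReal.coe_ne_top
  have hMbR : Mb = ENNReal.ofReal (C * A / ν ^ 2) := by
    rw [hMb, hCα, ← ENNReal.ofReal_ofNat 2, ← ENNReal.ofReal_mul (by norm_num)]
    congr 1
    field_simp
  have hE0 : ∀ᵐ s ∂(volume.restrict (Ioo (0 : ℝ) S')),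
      ∫⁻ y in ball (0 : EuclideanSpace ℝ (Fin 3)) 1,
        ‖(fun s y => (r / ν) • u (t₀ + r ^ 2 / ν * s) (x + r • y)) s y‖ₑ ^ 2 ≤ Mb :=
    hE.mono fun s hs => hs 0
  have hD0' : ∫⁻ z in Ioo (0 : ℝ) S' ×ˢ ball (0 : EuclideanSpace ℝ (Fin 3)) 1,
      ENNReal.ofReal (frobeniusNormSq (G₁ z.1 z.2)) ≤ Mb :=
    hD0.trans (by rw [hMb]; exact le_mul_of_one_le_left bot_le one_le_two)
  have hcube := hKc _ G₁ Tsl 0 S' 0 Mb le_rfl hS'pos.le hS'Tsl (by rw [sub_zero]; exact hS'1) hMbtop hG₁ hE0 hD0'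
  have hcube' : ∫⁻ z in Ioo (0 : ℝ) S' ×ˢ ball (0 : EuclideanSpace ℝ (Fin 3)) 1,
      ‖((r / ν) • stPull β r t₀ x u) z.1 z.2‖ₑ ^ (3 : ℕ) ≤ 2 * Kc * Mb ^ (3 / 2 : ℝ) := by
    rw [← hUeq]
    refine hcube.trans ?_
    have h1 : ENNReal.ofReal (S' - 0) ^ (1 / 4 : ℝ) ≤ 1 :=
      ENNReal.rpow_le_one (ENNReal.ofReal_le_one.2 (by linarith)) (by norm_num)
    calc 2 * (Kc : ℝ≥0∞) * Mb ^ (3 / 2 : ℝ) * ENNReal.ofReal (S' - 0) ^ (1 / 4 : ℝ)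
        ≤ 2 * (Kc : ℝ≥0∞) * Mb ^ (3 / 2 : ℝ) * 1 := by gcongr
      _ = 2 * Kc * Mb ^ (3 / 2 : ℝ) := mul_one _
  have hCorig : ENNReal.ofReal ((ν ^ 2 * r ^ 2)⁻¹) * ∫⁻ z in Scyl, ‖u z.1 z.2‖ₑ ^ (3 : ℕ) ≤
      2 * Kc * Mb ^ (3 / 2 : ℝ) := by
    have h := setLIntegral_enorm_pow_stRescale hβpos hr t₀ x (r / ν) u Scyl 3
    rw [hpre, finrank_euclideanSpace_fin, cubic_factor_eq hν hr] at h
    rw [← h]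
    exact hcube'
  have hMb32 : Mb ^ (3 / 2 : ℝ) = ENNReal.ofReal ((C : ℝ) ^ (3 / 2 : ℝ) * A ^ (3 / 2 : ℝ) / ν ^ 3) := by
    rw [hMbR, ENNReal.ofReal_rpow_of_nonneg (by positivity) (by norm_num)]
    congr 1
    rw [Real.div_rpow (by positivity) (by positivity), Real.mul_rpow C.coe_nonneg hA.le]
    congr 1
    rw [← Real.rpow_natCast ν 2, ← Real.rpow_mul hν.le]
    norm_num
  have hCfin : ∫⁻ z in Scyl, ‖u z.1 z.2‖ₑ ^ (3 : ℕ) ≤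
      ENNReal.ofReal (2 * Kc * (C : ℝ) ^ (3 / 2 : ℝ) * A ^ (3 / 2 : ℝ) * r ^ 2 / ν) := by
    have h := le_inv_mul_of_ofReal_mul_le (by positivity) hCorig
    refine h.trans (le_of_eq ?_)
    rw [inv_inv, hMb32, ← ENNReal.ofReal_coe_nnreal, ← ENNReal.ofReal_ofNat 2, ← ENNReal.ofReal_mul (by norm_num),
      ← ENNReal.ofReal_mul (by positivity), ← ENNReal.ofReal_mul (by positivity)]
    congr 1
    field_simp
  -- ### conclusion on the causal cylinder (a sub-cylinder of the JS window)
  exact ⟨(lintegral_mono_set hsubcyl).trans hEfin, (lintegral_mono_set hsubcyl).trans hCfin⟩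

end Summit.NavierStokesRegularity.NavierStokesRegularity.Theorems.L3TimeExponentPincerScaledEnergyCausalCylinder

end
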